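import Summits.ResolutionOfSingularities.ResolutionOfSingularities.Theorems.FrobeniusLadderFInjectiveMacaulayficationSequentialSurgeryGlueOfClass
import Summits.ResolutionOfSingularities.ResolutionOfSingularities.Theorems.FrobeniusLadderFInjectiveMacaulayficationCertifiedChartCentre
import Summits.ResolutionOfSingularities.ResolutionOfSingularities.Theorems.FrobeniusLadderFInjectiveMacaulayficationCertifiedChartTransport
import HarnessLib

/-!
# T-𝒫: `FInjectiveMacaulayfication` on the CERTIFIED-CHART CLASS — §4a of `ClassGlueSig` (crux stmt-ResolutionOfSingularities-15315, chain w45a)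

[OURS · L1 W4.5a · res-D-pv-019 AS res-L1-w45a-stub-7] Support file (`--supports stmt-ResolutionOfSingularities-15315 --as helper`)
for the crux `FrobeniusLadder.FInjectiveMacaulayfication`; NOT a statement of any manuscript; AI-written, weaker than expert review.
Ruling R11.8 of res-L1-w45a-plan-1 (HOME/STATUS 07:15:20Z): the statement is §4a of `L/w45a/ClassGlueSig.lean` (v2 sha16
239444958d057f2d = v3 sha16 74b6a04e74c75940, l.283–311) VERBATIM, with the three sketch names replaced by the landed theorems
(and the unused binder `f₁` of the class lambda spelled `_` for the linter).

THE THEOREM (`fInjectiveMacaulayfication_of_certifiedChartClass`). Fix a prime `p` and a field `k` of characteristic `p`. Let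
`X₁ → Spec k` be separated, locally of finite type, quasi-compact, with `X₁` integral, all local rings Cohen–Macaulay (inline:
every system of parameters is weakly regular) and only finitely many local rings failing the F-injectivity clause. Suppose every
BAD closed point `b` (a point whose local ring fails the clause) is a CERTIFIED-CHART point: inside every open neighbourhood `W ∋ b`
there is an affine open `U ∋ b` on which `b` is the only bad point, `Γ(X₁, U)` has characteristic `p`, and there is an ideal
`I ≠ ⊥` of `Γ(X₁, U)` cutting out exactly `{b}` together with E6‴-format cover certificates — finitely many nonzero `v_j ∈ I`
whose Rees elements cover the irrelevant ideal up to radical, such that every localisation of every affine blowup algebra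
`Γ(X₁, U)[I/v_j]` at a maximal ideal containing `v_j` is Cohen–Macaulay and F-injective (inline clauses). THEN `X₁` has a proper
birational model all of whose local rings are domains, Cohen–Macaulay and F-injective — the conclusion of the crux for `X₁`.

PROOF = composition of three landed theorems, exactly as in the Sig file: G-β-rel
`SequentialSurgeryGlueOfClass.sequentialSurgeryGlueOfClass` (p505685) applied to the certified-chart class `P_cert` (written
inline), with its transport hypothesis (iii) discharged by `CertifiedChartTransport.certifiedChartClass_transport` (p507329) and
its closed-centre hypothesis (ii) by `CertifiedChartCentre.certifiedChartClass_h4` (p506797, res-L1-w45a-stub-3). Zero named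
facts (no Kawasaki, no Datta–Murayama), no `sorry`.
-/

-- single-problem summit: the doubled namespace component is forced
set_option linter.dupNamespace false

noncomputable section

namespace Summit.ResolutionOfSingularities.ResolutionOfSingularities.Theorems.FInjectiveMacaulayfication.OfCertifiedChartClass

open AlgebraicGeometry CategoryTheory Literature.AlgebraicGeometry.Resolution TopologicalSpace
open Summit.ResolutionOfSingularities.ResolutionOfSingularities.Theorems.FInjectiveMacaulayfication

/-- **§4a — T-𝒫: F-INJECTIVE MACAULAYFICATION ON THE CERTIFIED-CHART CLASS** [OURS · `ClassGlueSig` v3 74b6a04e74c75940 §4a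
verbatim]: an admissible pair `X₁ → Spec k` (separated, locally of finite type, quasi-compact, integral, Cohen–Macaulay stalks,
finitely many non-F-injective stalks) all of whose bad closed points are certified-chart points has a proper birational model with
domain + Cohen–Macaulay + F-injective stalks. Composition of G-β-rel `sequentialSurgeryGlueOfClass` with
`certifiedChartClass_transport` (hypothesis (iii)) and `certifiedChartClass_h4` (hypothesis (ii)). [folklore] -/
theorem fInjectiveMacaulayfication_of_certifiedChartClass (p : ℕ) (hp : p.Prime) (k : Type) [Field k] [CharP k p]
    (X₁ : Scheme.{0}) (f₁ : X₁ ⟶ Spec (.of k)) (hsep : IsSeparated f₁) (hft : LocallyOfFiniteType f₁) (hqc : QuasiCompact f₁)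
    (hint : IsIntegral X₁) (hCM : ∀ x : X₁, ∀ d : ℕ, ringKrullDim (X₁.presheaf.stalk x) = d → ∀ s : Fin d → X₁.presheaf.stalk x, (Ideal.span (Set.range s)).radical.IsMaximal → RingTheory.Sequence.IsWeaklyRegular (X₁.presheaf.stalk x) (List.ofFn s)) (hfin : Set.Finite {x : X₁ | ¬ ∀ d : ℕ, ringKrullDim (X₁.presheaf.stalk x) = d → ∀ s : Fin d → X₁.presheaf.stalk x, (Ideal.span (Set.range s)).radical.IsMaximal → ∀ y : X₁.presheaf.stalk x, (∃ e : ℕ, y ^ p ^ e ∈ Ideal.span ((fun z : X₁.presheaf.stalk x => z ^ p ^ e) '' (Ideal.span (Set.range s) : Set (X₁.presheaf.stalk x)))) → y ∈ Ideal.span (Set.range s)})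
    (hcl : ∀ b : X₁, (¬ ∀ d : ℕ, ringKrullDim (X₁.presheaf.stalk b) = d → ∀ s : Fin d → X₁.presheaf.stalk b, (Ideal.span (Set.range s)).radical.IsMaximal → ∀ y : X₁.presheaf.stalk b, (∃ e : ℕ, y ^ p ^ e ∈ Ideal.span ((fun z : X₁.presheaf.stalk b => z ^ p ^ e) '' (Ideal.span (Set.range s) : Set (X₁.presheaf.stalk b)))) → y ∈ Ideal.span (Set.range s)) →
      ∀ W : X₁.Opens, b ∈ W → ∃ U : X₁.affineOpens, (U : X₁.Opens) ≤ W ∧ b ∈ (U : X₁.Opens) ∧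
        (∀ x : X₁, x ∈ (U : X₁.Opens) → x ≠ b → ∀ d : ℕ, ringKrullDim (X₁.presheaf.stalk x) = d → ∀ s : Fin d → X₁.presheaf.stalk x, (Ideal.span (Set.range s)).radical.IsMaximal → ∀ y : X₁.presheaf.stalk x, (∃ e : ℕ, y ^ p ^ e ∈ Ideal.span ((fun z : X₁.presheaf.stalk x => z ^ p ^ e) '' (Ideal.span (Set.range s) : Set (X₁.presheaf.stalk x)))) → y ∈ Ideal.span (Set.range s)) ∧
        CharP Γ(X₁, U) p ∧ ∃ (I : Ideal Γ(X₁, U)), I ≠ ⊥ ∧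
        (∀ (x : X₁) (hx : x ∈ (U : X₁.Opens)), I ≤ (U.2.primeIdealOf ⟨x, hx⟩).asIdeal ↔ x = b) ∧
        ∃ (t : ℕ) (v : Fin t → Γ(X₁, U)) (hv : ∀ j : Fin t, v j ∈ I),
          (HomogeneousIdeal.irrelevant (reesGrading I)).toIdeal ≤ (Ideal.span (Set.range fun j : Fin t => reesT (I := I) (v j) (hv j))).radical ∧
          (∀ j : Fin t, v j ≠ 0) ∧
          ∀ (j : Fin t) (Q : Ideal (Literature.AlgebraicGeometry.Resolution.blowupAlgebra I (v j))) [Q.IsMaximal],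
            algebraMap Γ(X₁, U) (Literature.AlgebraicGeometry.Resolution.blowupAlgebra I (v j)) (v j) ∈ Q →
            ∀ d : ℕ, ringKrullDim (Localization.AtPrime Q) = d → ∀ s : Fin d → Localization.AtPrime Q, (Ideal.span (Set.range s)).radical.IsMaximal → RingTheory.Sequence.IsWeaklyRegular (Localization.AtPrime Q) (List.ofFn s) ∧ ∀ y : Localization.AtPrime Q, (∃ e : ℕ, y ^ p ^ e ∈ Ideal.span ((fun z : Localization.AtPrime Q => z ^ p ^ e) '' (Ideal.span (Set.range s) : Set (Localization.AtPrime Q)))) → y ∈ Ideal.span (Set.range s)) :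
    ∃ (X' : Scheme.{0}) (π : X' ⟶ X₁), IsProper π ∧ Literature.AlgebraicGeometry.Resolution.IsBirational π ∧
      ∀ x : X', IsDomain (X'.presheaf.stalk x) ∧ ∀ d : ℕ, ringKrullDim (X'.presheaf.stalk x) = d → ∀ s : Fin d → X'.presheaf.stalk x, (Ideal.span (Set.range s)).radical.IsMaximal → RingTheory.Sequence.IsWeaklyRegular (X'.presheaf.stalk x) (List.ofFn s) ∧ ∀ y : X'.presheaf.stalk x, (∃ e : ℕ, y ^ p ^ e ∈ Ideal.span ((fun z : X'.presheaf.stalk x => z ^ p ^ e) '' (Ideal.span (Set.range s) : Set (X'.presheaf.stalk x)))) → y ∈ Ideal.span (Set.range s) :=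
  SequentialSurgeryGlueOfClass.sequentialSurgeryGlueOfClass p hp k
    (fun X₁ _ b => ∀ W : X₁.Opens, b ∈ W → ∃ U : X₁.affineOpens, (U : X₁.Opens) ≤ W ∧ b ∈ (U : X₁.Opens) ∧
        (∀ x : X₁, x ∈ (U : X₁.Opens) → x ≠ b → ∀ d : ℕ, ringKrullDim (X₁.presheaf.stalk x) = d → ∀ s : Fin d → X₁.presheaf.stalk x, (Ideal.span (Set.range s)).radical.IsMaximal → ∀ y : X₁.presheaf.stalk x, (∃ e : ℕ, y ^ p ^ e ∈ Ideal.span ((fun z : X₁.presheaf.stalk x => z ^ p ^ e) '' (Ideal.span (Set.range s) : Set (X₁.presheaf.stalk x)))) → y ∈ Ideal.span (Set.range s)) ∧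
        CharP Γ(X₁, U) p ∧ ∃ (I : Ideal Γ(X₁, U)), I ≠ ⊥ ∧
        (∀ (x : X₁) (hx : x ∈ (U : X₁.Opens)), I ≤ (U.2.primeIdealOf ⟨x, hx⟩).asIdeal ↔ x = b) ∧
        ∃ (t : ℕ) (v : Fin t → Γ(X₁, U)) (hv : ∀ j : Fin t, v j ∈ I),
          (HomogeneousIdeal.irrelevant (reesGrading I)).toIdeal ≤ (Ideal.span (Set.range fun j : Fin t => reesT (I := I) (v j) (hv j))).radical ∧
          (∀ j : Fin t, v j ≠ 0) ∧
          ∀ (j : Fin t) (Q : Ideal (Literature.AlgebraicGeometry.Resolution.blowupAlgebra I (v j))) [Q.IsMaximal],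
            algebraMap Γ(X₁, U) (Literature.AlgebraicGeometry.Resolution.blowupAlgebra I (v j)) (v j) ∈ Q →
            ∀ d : ℕ, ringKrullDim (Localization.AtPrime Q) = d → ∀ s : Fin d → Localization.AtPrime Q, (Ideal.span (Set.range s)).radical.IsMaximal → RingTheory.Sequence.IsWeaklyRegular (Localization.AtPrime Q) (List.ofFn s) ∧ ∀ y : Localization.AtPrime Q, (∃ e : ℕ, y ^ p ^ e ∈ Ideal.span ((fun z : Localization.AtPrime Q => z ^ p ^ e) '' (Ideal.span (Set.range s) : Set (Localization.AtPrime Q)))) → y ∈ Ideal.span (Set.range s))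
    (CertifiedChartTransport.certifiedChartClass_transport p hp k) (CertifiedChartCentre.certifiedChartClass_h4 p hp k)
    X₁ f₁ hsep hft hqc hint hCM hfin hcl

end Summit.ResolutionOfSingularities.ResolutionOfSingularities.Theorems.FInjectiveMacaulayfication.OfCertifiedChartClass

end
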